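import Summits.AtomisticToContinuum.HydrodynamicLimit.Theorems.RelayRaceLocalityConeLocalisationStubLogSlopeB
import Literature.Analysis.FluidPDE.TransportHolderEstimate
import Literature.MathematicalPhysics.KineticTheory.HardSphereEulerSolutionGluing
import Summits.AtomisticToContinuum.HydrodynamicLimit.Theorems.RestartPrinciple.Negative.ConsequentImpAntecedent
import HarnessLib

/-!
# RelayRaceLocality · ConeLocalisation — line `einstein-elevator`, stub `stub_logSlope`

Support file for the crux item `stmt-AtomisticToContinuum-12504` (`ConeLocalisation`, route RelayRaceLocality of
`AtomisticToContinuum/HydrodynamicLimit`), proving the registered stub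

  `stub_logSlope : DynamicLogSlopeBound`

of the skeleton of the line `einstein-elevator` (Props in
`Theorems/RelayRaceLocalityConeLocalisationElevatorDefs.lean`): the floor-free a-priori estimate
`|∂ᵢ log ρ| ≤ C Mᵃ / t` on `[0, t] × 𝕋³` for ONE classical hard-sphere Euler solution whose level-`M`
guards survive on `[0, t] × 𝕋³` (third of three files; parts A, B carry the ODE lemma, the EOS band
and the Eulerian identities/bounds).

## Proof (Lagrangian both-ends argument)

Along a characteristic `γ` of `u` (method of characteristics on the torus,
`Torus.exists_characteristic`), `D_t uⱼ = -Gⱼ` with `G = ∇p/ρ = θ κ(ρσ³) ∇log ρ + Z(ρσ³) ∇θ`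
(`κ = Z + η Z'`, `Z` the smooth compressibility factor at low density, `hsEosLowDensity_proof`), and
from the mass and temperature equations `|D_t G| ≤ A ‖G‖ + B` with `A, B` polynomial in `M` — the
`1/ρ`'s cancel in `D_t ∂ⱼ log ρ = -∂ⱼ div u - Σₖ ∂ⱼuₖ ∂ₖ log ρ`. Since `‖u‖ ≤ M` at both ends of
the path, `‖∫ G‖ ≤ 2M`, whence `‖G‖ ≤ C M / t` (the both-ends ODE lemma `norm_le_of_both_ends`),
and `|∂ᵢ log ρ| ≤ 2M (‖G‖ + K M)`. No density floor enters. The packing guard on `[0, t]` is first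
extended to a slab `[0, T')` (`exists_packing_extension`) and the solution restricted to it.
-/

noncomputable section

namespace Summit.AtomisticToContinuum.HydrodynamicLimit.Theorems.ConeLocalisation.Elevator

open scoped Topology ContDiff NNReal
open Filter Set MeasureTheory
open Literature.MathematicalPhysics.KineticTheory Literature.Analysis.FluidPDE
  Literature.Analysis.FunctionSpaces
open Literature.Analysis.FluidPDE.CompressibleEuler (abs_mul_le_of_le)

namespace LogSlope

section Lagrangian

variable {σ T η₀ : ℝ} {ρ θ : ℝ → T3 → ℝ} {u : ℝ → T3 → V3} {Zf : ℝ → ℝ}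

/-! ### Step 7: along a characteristic -/

/-- Derivative along a characteristic `γ` (`γ' = u(s, γ)` within `[0, t]`) of a field jointly
smooth on `[0, T)`, `t < T`: `d/ds F(s, γ(s)) = ∂ₜF + Σᵢ uᵢ ∂ᵢF` (material derivative, with the
solution's one-sided time derivative within `[0, T)`). [folklore] -/
theorem hasDerivWithinAt_along {t : ℝ} {F : ℝ → T3 → ℝ}
    (hF : Torus.IsSmoothSpaceTimeOn (Ico 0 T) F) (ht : 0 < t) (htT : t < T)
    {γ : ℝ → V3} {τ : ℝ} (hτ : τ ∈ Icc 0 t)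
    (hγ : HasDerivWithinAt γ (Torus.lift (u τ) (γ τ)) (Icc 0 t) τ) {y : T3}
    (hy : Torus.proj (γ τ) = y) :
    HasDerivWithinAt (fun s => F s (Torus.proj (γ s)))
      (Torus.timeDerivWithin (Ico 0 T) F τ y + ∑ i, u τ y i * Torus.partialDeriv i (F τ) y)
      (Icc 0 t) τ := by
  subst hy
  have hsub : Icc 0 t ⊆ Ico 0 T := Icc_subset_Ico_right htT
  have hτ' : τ ∈ Ico 0 T := hsub hτ
  have h := Torus.hasDerivWithinAt_comp_characteristic ht (hF.mono hsub) hτ hγ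
  have e1 : Torus.timeDerivWithin (Icc 0 t) F τ (Torus.proj (γ τ)) =
      Torus.timeDerivWithin (Ico 0 T) F τ (Torus.proj (γ τ)) :=
    ((hF.hasDerivWithinAt_slice hτ' _).mono hsub).derivWithin (uniqueDiffOn_Icc ht τ hτ)
  have e2 : Torus.convect (u τ) (F τ) (Torus.proj (γ τ)) =
      ∑ i, u τ (Torus.proj (γ τ)) i * Torus.partialDeriv i (F τ) (Torus.proj (γ τ)) := by
    rw [Torus.convect_eq_sum_smul_partialDeriv ((hF.isSmooth_slice hτ').isContDiff (by simp))]
    simp only [smul_eq_mul]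
  rw [e1, e2] at h
  exact h

/-- **The Lagrangian step.** Along a characteristic `γ` within `[0, t]` of a classical solution whose
level-`M` guards hold on `[0, t] × 𝕋³` (packing `< η₁` on `[0, T)`, `N = K M`): with
`Gⱼ = θ κ(ρσ³) ∂ⱼ log ρ + Zf(ρσ³) ∂ⱼθ` evaluated along `γ`, (i) `d/ds uⱼ(s, γ s) = -Gⱼ`,
(ii) `|∂ⱼ log ρ| ≤ 2N (‖G‖ + N²)`, (iii) `‖d/ds G(s, γ s)‖ ≤ 38 N⁵ ‖G‖ + 62 N⁷`. [folklore] -/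
theorem lagrangian_step (hE : IsHardSphereEulerSolution σ T ρ u θ)
    (hZ : ContDiffOn ℝ ∞ Zf (Ioo (-η₀) η₀)) (hEq : EqOn hsCompressibility Zf (Ioo 0 η₀))
    (hσ : 0 < σ) (hσ1 : σ ≤ 1) {η₁ K M N : ℝ} (hη₁1 : η₁ ≤ 1) (hη₁₀ : 2 * η₁ ≤ η₀)
    (hband : ∀ η ∈ Icc 0 η₁, |Zf η| ≤ K ∧ |deriv Zf η| ≤ K ∧ |deriv (deriv Zf) η| ≤ K ∧
      1 / 2 ≤ Zf η ∧ 1 / 2 ≤ Zf η + η * deriv Zf η)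
    (hN : 1 ≤ N) (hM : 1 ≤ M) (hMN : M ≤ N) (hKN : K ≤ N)
    (hpack : ∀ s ∈ Ico 0 T, ∀ x, ρ s x * σ ^ 3 < η₁)
    {t : ℝ} (ht : 0 < t) (htT : t < T) (hG : ∀ s ∈ Icc 0 t, ∀ x, GuardAt η₁ M σ ρ θ u s x)
    {γ : ℝ → V3} {τ : ℝ} (hτ : τ ∈ Icc 0 t)
    (hγ : HasDerivWithinAt γ (Torus.lift (u τ) (γ τ)) (Icc 0 t) τ) (y : T3)
    (hy : Torus.proj (γ τ) = y) {g : ℝ → Fin 3 → ℝ}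
    (hg : ∀ s j, g s j = θ s (Torus.proj (γ s)) *
        (Zf (ρ s (Torus.proj (γ s)) * σ ^ 3) +
          ρ s (Torus.proj (γ s)) * σ ^ 3 * deriv Zf (ρ s (Torus.proj (γ s)) * σ ^ 3)) *
        Torus.partialDeriv j (fun z => Real.log (ρ s z)) (Torus.proj (γ s)) +
      Zf (ρ s (Torus.proj (γ s)) * σ ^ 3) * Torus.partialDeriv j (θ s) (Torus.proj (γ s))) :
    (∀ j, HasDerivWithinAt (fun s => u s (Torus.proj (γ s)) j) (-g τ j) (Icc 0 t) τ) ∧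
    (∀ j, |Torus.partialDeriv j (fun z => Real.log (ρ τ z)) y| ≤ 2 * N * (‖g τ‖ + N ^ 2)) ∧
    ∃ v : Fin 3 → ℝ, HasDerivWithinAt g v (Icc 0 t) τ ∧
      ‖v‖ ≤ 38 * N ^ 5 * ‖g τ‖ + 62 * N ^ 7 := by
  have hsub : Icc 0 t ⊆ Ico 0 T := Icc_subset_Ico_right htT
  have hτ' : τ ∈ Ico 0 T := hsub hτ
  have hGτ := hG τ hτ y
  have hρpos := hE.density_pos τ hτ' y
  have hθpos := hE.temperature_pos τ hτ' y
  have hη₁ : 0 < η₁ := (mul_pos hρpos (pow_pos hσ 3)).trans hGτ.1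
  have hη₀ : ∀ s ∈ Ico 0 T, ∀ x, ρ s x * σ ^ 3 < η₀ := fun s' hs' x' =>
    (hpack s' hs' x').trans_le (by linarith)
  have hus : Torus.IsSmooth (u τ) := hE.smooth_velocity.isSmooth_slice hτ'
  obtain ⟨hpk, hθN, hθM, -, -, hdθ, -, -, -⟩ := guard_bounds hGτ hMN hus
  have hN0 : 0 < N := by linarith
  have hθlow : N⁻¹ ≤ θ τ y := (inv_anti₀ (by linarith) hMN).trans hθM
  -- the EOS at `η = ρ σ³`
  have hηpos : 0 < ρ τ y * σ ^ 3 := mul_pos hρpos (pow_pos hσ 3)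
  have hηmem : ρ τ y * σ ^ 3 ∈ Icc 0 η₁ := ⟨hηpos.le, hpk.le⟩
  have hηmem' : ρ τ y * σ ^ 3 ∈ Ioo (-η₀) η₀ := ⟨by linarith, by linarith⟩
  obtain ⟨bZ, bZ', bZ'', -, lκ⟩ := hband _ hηmem
  have hθa : |θ τ y| ≤ N := by rw [abs_of_pos hθpos]; exact hθN
  have hZa : |Zf (ρ τ y * σ ^ 3)| ≤ N := bZ.trans hKN
  have hZ'a : |deriv Zf (ρ τ y * σ ^ 3)| ≤ N := bZ'.trans hKN
  have hZ''a : |deriv (deriv Zf) (ρ τ y * σ ^ 3)| ≤ N := bZ''.trans hKN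
  have hη1 : |ρ τ y * σ ^ 3| ≤ 1 := by rw [abs_of_pos hηpos]; exact hpk.le.trans hη₁1
  have hκa : |Zf (ρ τ y * σ ^ 3) + ρ τ y * σ ^ 3 * deriv Zf (ρ τ y * σ ^ 3)| ≤ 2 * N :=
    (abs_add_le _ _).trans (by linarith [abs_mul_le_of_le hη1 hZ'a])
  have hκ'a : |deriv Zf (ρ τ y * σ ^ 3) + (1 * deriv Zf (ρ τ y * σ ^ 3) +
      ρ τ y * σ ^ 3 * deriv (deriv Zf) (ρ τ y * σ ^ 3))| ≤ 3 * N := by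
    rw [one_mul]
    have h1 := abs_mul_le_of_le hη1 hZ''a
    have h2 := abs_add_le (deriv Zf (ρ τ y * σ ^ 3))
      (ρ τ y * σ ^ 3 * deriv (deriv Zf) (ρ τ y * σ ^ 3))
    have h3 := abs_add_le (deriv Zf (ρ τ y * σ ^ 3))
      (deriv Zf (ρ τ y * σ ^ 3) + ρ τ y * σ ^ 3 * deriv (deriv Zf) (ρ τ y * σ ^ 3))
    linarith
  -- one-variable derivatives of `Zf`, `Zf'`, `κ` at `η`, re-based at `ρ τ (proj (γ τ)) σ³`
  have hO : IsOpen (Ioo (-η₀) η₀) := isOpen_Ioo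
  have hZ1 : ContDiffOn ℝ ∞ (deriv Zf) (Ioo (-η₀) η₀) := hZ.deriv_of_isOpen hO le_rfl
  have dZ : HasDerivAt Zf (deriv Zf (ρ τ y * σ ^ 3)) (ρ τ (Torus.proj (γ τ)) * σ ^ 3) := by
    rw [hy]
    exact ((hZ.differentiableOn (by simp)).differentiableAt (hO.mem_nhds hηmem')).hasDerivAt
  have dZ1 : HasDerivAt (deriv Zf) (deriv (deriv Zf) (ρ τ y * σ ^ 3))
      (ρ τ (Torus.proj (γ τ)) * σ ^ 3) := by
    rw [hy]
    exact ((hZ1.differentiableOn (by simp)).differentiableAt (hO.mem_nhds hηmem')).hasDerivAt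
  have dκ : HasDerivAt (fun e => Zf e + e * deriv Zf e)
      (deriv Zf (ρ τ y * σ ^ 3) + (1 * deriv Zf (ρ τ y * σ ^ 3) +
        ρ τ y * σ ^ 3 * deriv (deriv Zf) (ρ τ y * σ ^ 3))) (ρ τ (Torus.proj (γ τ)) * σ ^ 3) := by
    have h := dZ.fun_add ((hasDerivAt_id' (ρ τ (Torus.proj (γ τ)) * σ ^ 3)).fun_mul dZ1)
    rw [hy] at h ⊢
    exact h
  -- derivatives along `γ`
  have aθ := hasDerivWithinAt_along hE.smooth_temperature ht htT hτ hγ hy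
  have aη := (hasDerivWithinAt_along hE.smooth_density ht htT hτ hγ hy).mul_const (σ ^ 3)
  have hL := isSmoothSpaceTimeOn_log hE
  have hU : UniqueDiffOn ℝ (Ico (0 : ℝ) T) := uniqueDiffOn_Ico 0 T
  -- material-derivative bounds at `(τ, y)`
  obtain ⟨bθ, bρ, bΘ, bQ⟩ :=
    pointwise_bounds hE hZ hEq hσ hσ1 hη₁1 hη₁₀ hband hN hMN hKN hpack hτ' hGτ
  generalize hDθ : Torus.timeDerivWithin (Ico 0 T) θ τ y +
    ∑ i, u τ y i * Torus.partialDeriv i (θ τ) y = Dθ at aθ bθ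
  generalize hDη : (Torus.timeDerivWithin (Ico 0 T) ρ τ y +
    ∑ i, u τ y i * Torus.partialDeriv i (ρ τ) y) * σ ^ 3 = Dη at aη bρ
  -- (i) the velocity along `γ`
  have part1 : ∀ j, HasDerivWithinAt (fun s => u s (Torus.proj (γ s)) j) (-g τ j) (Icc 0 t) τ := by
    intro j
    refine (hasDerivWithinAt_along (hE.smooth_velocity.apply j) ht htT hτ hγ hy).congr_deriv ?_
    rw [hg, hy, Dt_velocity hE hZ hEq hσ hη₀ hτ' y j, partialDeriv_log hE hτ' y j]
  -- (ii) inverting `G` for the log-slope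
  have part2 : ∀ j, |Torus.partialDeriv j (fun z => Real.log (ρ τ z)) y| ≤
      2 * N * (‖g τ‖ + N ^ 2) := by
    intro j
    refine (abs_slope_le hN hθlow lκ hZa (hdθ j)).trans ?_
    have e : θ τ y * (Zf (ρ τ y * σ ^ 3) + ρ τ y * σ ^ 3 * deriv Zf (ρ τ y * σ ^ 3)) *
        Torus.partialDeriv j (fun z => Real.log (ρ τ z)) y +
        Zf (ρ τ y * σ ^ 3) * Torus.partialDeriv j (θ τ) y = g τ j := by
      rw [hg, hy]
    rw [e]
    have h1 : |g τ j| ≤ ‖g τ‖ := by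
      have h := norm_le_pi_norm (g τ) j
      rwa [Real.norm_eq_abs] at h
    gcongr
  have hS : ∑ i, |Torus.partialDeriv i (fun z => Real.log (ρ τ z)) y| ≤
      3 * (2 * N * (‖g τ‖ + N ^ 2)) := by
    simp only [Fin.sum_univ_three]
    linarith [part2 0, part2 1, part2 2]
  -- (iii) the derivative of `G` along `γ`, componentwise
  have part3 : ∀ j, ∃ d, HasDerivWithinAt (fun s => g s j) d (Icc 0 t) τ ∧
      |d| ≤ 38 * N ^ 5 * ‖g τ‖ + 62 * N ^ 7 := by
    intro j
    have aΘ := hasDerivWithinAt_along (hE.smooth_temperature.partialDeriv hU j) ht htT hτ hγ hy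
    have aQ := hasDerivWithinAt_along (hL.partialDeriv hU j) ht htT hτ hγ hy
    have bΘj := bΘ j
    have bQj := bQ j
    generalize hDΘ : Torus.timeDerivWithin (Ico 0 T) (fun s => Torus.partialDeriv j (θ s)) τ y +
      ∑ i, u τ y i * Torus.partialDeriv i (Torus.partialDeriv j (θ τ)) y = DΘ at aΘ bΘj
    generalize hDQ : Torus.timeDerivWithin (Ico 0 T)
        (fun s => Torus.partialDeriv j (fun z => Real.log (ρ s z))) τ y +
      ∑ i, u τ y i * Torus.partialDeriv i
        (Torus.partialDeriv j (fun z => Real.log (ρ τ z))) y = DQ at aQ bQj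
    have e : (fun s => g s j) = fun s => θ s (Torus.proj (γ s)) *
        (Zf (ρ s (Torus.proj (γ s)) * σ ^ 3) +
          ρ s (Torus.proj (γ s)) * σ ^ 3 * deriv Zf (ρ s (Torus.proj (γ s)) * σ ^ 3)) *
        Torus.partialDeriv j (fun z => Real.log (ρ s z)) (Torus.proj (γ s)) +
      Zf (ρ s (Torus.proj (γ s)) * σ ^ 3) * Torus.partialDeriv j (θ s) (Torus.proj (γ s)) :=
      funext fun s => hg s j
    refine ⟨(Dθ * (Zf (ρ τ y * σ ^ 3) + ρ τ y * σ ^ 3 * deriv Zf (ρ τ y * σ ^ 3)) +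
        θ τ y * ((deriv Zf (ρ τ y * σ ^ 3) + (1 * deriv Zf (ρ τ y * σ ^ 3) +
          ρ τ y * σ ^ 3 * deriv (deriv Zf) (ρ τ y * σ ^ 3))) * Dη)) *
        Torus.partialDeriv j (fun z => Real.log (ρ τ z)) y +
      θ τ y * (Zf (ρ τ y * σ ^ 3) + ρ τ y * σ ^ 3 * deriv Zf (ρ τ y * σ ^ 3)) * DQ +
      (deriv Zf (ρ τ y * σ ^ 3) * Dη * Torus.partialDeriv j (θ τ) y +
        Zf (ρ τ y * σ ^ 3) * DΘ), ?_, ?_⟩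
    · rw [e]
      have hcomp := ((aθ.fun_mul (dκ.comp_hasDerivWithinAt τ aη)).fun_mul aQ).fun_add
        ((dZ.comp_hasDerivWithinAt τ aη).fun_mul aΘ)
      simp only [Function.comp_apply, hy] at hcomp
      exact hcomp
    · exact abs_DtG_le hN (norm_nonneg _) hθa hκa hκ'a hZa hZ'a (hdθ j) bθ bρ bΘj (part2 j)
        bQj hS
  choose d hd hdb using part3
  refine ⟨part1, part2, d, hasDerivWithinAt_pi.2 hd, ?_⟩
  refine (pi_norm_le_iff_of_nonneg (by positivity)).2 fun j => ?_
  rw [Real.norm_eq_abs]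
  exact hdb j

end Lagrangian

end LogSlope

open LogSlope

/-! ### Step 8: the stub -/

/-- **STUB `stub_logSlope` of the line `einstein-elevator`** (registered on
stmt-AtomisticToContinuum-12504): the dynamic log-slope bound — the level-`M` guards of `S` alive on
`[0, t] × 𝕋³` force `|∂ᵢ log ρ| ≤ C Mᵃ / t` there, with NO density floor (`η₁` the EOS band of
`eos_band`, `C = 256 K⁸`, `a = 8`; Lagrangian both-ends argument). [folklore] -/
theorem stub_logSlope : DynamicLogSlopeBound := by
  obtain ⟨η₀, η₁, K, Zf, hη₁, hη₁1, hη₁₀, hK, hZ, hEq, hband⟩ := eos_band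
  refine ⟨η₁, hη₁, 256 * K ^ 8, by positivity, 8, ?_⟩
  intro M hM σ T₀ ρ θ u hσ hσ1 hE₀ t ht htT₀ hsmall hG s hs x i
  -- restrict to a slab `[0, T)` on which the packing stays `< η₁`
  obtain ⟨T, htT, hTT₀, hpack⟩ := RestartPrincipleNegative.exists_packing_extension hE₀
    ⟨ht.le, htT₀⟩ (fun s hs x => (hG s hs x).1) hσ
  have hE : IsHardSphereEulerSolution σ T ρ u θ := hE₀.restrict hTT₀
  -- the level `N = K M`
  have hM0 : 0 < M := by linarith
  have hK0 : 0 < K := by linarith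
  have hN : 1 ≤ K * M := one_le_mul_of_one_le_of_one_le hK hM
  have hMN : M ≤ K * M := le_mul_of_one_le_left hM0.le hK
  have hKN : K ≤ K * M := le_mul_of_one_le_right hK0.le hM
  have hN0 : 0 < K * M := by linarith
  -- smallness of `t`
  have hpow : (256 : ℝ) * (K * M) ^ 8 = 256 * K ^ 8 * M ^ 8 := by rw [mul_pow, mul_assoc]
  have hsmall' : t * (256 * (K * M) ^ 8) ≤ 1 := by rw [hpow]; exact hsmall
  have hN8 : 1 ≤ (K * M) ^ 8 := one_le_pow₀ hN
  have ht0 : t ≠ 0 := ht.ne'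
  have ht1 : t ≤ 1 := by nlinarith
  have p58 : (K * M) ^ 5 ≤ (K * M) ^ 8 := pow_le_pow_right₀ hN (by norm_num)
  have hAt : 38 * (K * M) ^ 5 * (t - 0) ≤ 1 / 4 := by
    rw [sub_zero]
    nlinarith [mul_le_mul_of_nonneg_right p58 ht.le]
  -- Lipschitz bound for the characteristics on `[0, t]`
  have hsub : Icc 0 t ⊆ Ico 0 T := Icc_subset_Ico_right htT
  have hLip : ∀ τ ∈ Icc 0 t, LipschitzWith ⟨3 * M, by positivity⟩ (Torus.lift (u τ)) := by
    intro τ hτ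
    have hus : Torus.IsSmooth (u τ) := hE.smooth_velocity.isSmooth_slice (hsub hτ)
    have hu1 : Torus.IsContDiff 1 (u τ) := hus.isContDiff (by simp)
    refine Torus.lipschitzWith_lift_of_norm_fderiv_le hu1 fun z => ?_
    show ‖Torus.fderiv (u τ) z‖ ≤ 3 * M
    refine ContinuousLinearMap.opNorm_le_bound _ (by positivity) fun w => ?_
    rw [Torus.fderiv_apply_eq_sum_partialDeriv hu1]
    have hb : ∀ i, ‖Torus.partialDeriv i (u τ) z‖ ≤ M := fun i =>
      ((hG τ hτ z).2.2.2.2.2 i 0 0).2.1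
    calc ‖∑ i, w i • Torus.partialDeriv i (u τ) z‖
        ≤ ∑ i, ‖w i • Torus.partialDeriv i (u τ) z‖ := norm_sum_le _ _
      _ ≤ ∑ _i : Fin 3, ‖w‖ * M := Finset.sum_le_sum fun i _ => by
          rw [norm_smul]
          exact mul_le_mul (PiLp.norm_apply_le w i) (hb i) (norm_nonneg _) (norm_nonneg _)
      _ = 3 * M * ‖w‖ := by
          simp only [Finset.sum_const, Finset.card_univ, Fintype.card_fin, nsmul_eq_mul]
          push_cast
          ring
  -- the characteristic through `(s, x)`
  obtain ⟨γ, hγs, hγ⟩ :=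
    Torus.exists_characteristic (hE.smooth_velocity.mono hsub) hLip hs (Torus.repr x)
  have hx : Torus.proj (γ s) = x := by rw [hγs, Torus.proj_repr]
  -- `G` along `γ`
  obtain ⟨g, hg⟩ : ∃ g : ℝ → Fin 3 → ℝ, ∀ s' j, g s' j = θ s' (Torus.proj (γ s')) *
        (Zf (ρ s' (Torus.proj (γ s')) * σ ^ 3) +
          ρ s' (Torus.proj (γ s')) * σ ^ 3 * deriv Zf (ρ s' (Torus.proj (γ s')) * σ ^ 3)) *
        Torus.partialDeriv j (fun z => Real.log (ρ s' z)) (Torus.proj (γ s')) +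
      Zf (ρ s' (Torus.proj (γ s')) * σ ^ 3) * Torus.partialDeriv j (θ s') (Torus.proj (γ s')) :=
    ⟨_, fun _ _ => rfl⟩
  have step := fun τ (hτ : τ ∈ Icc 0 t) =>
    lagrangian_step hE hZ hEq hσ hσ1 hη₁1 hη₁₀ hband hN hM hMN hKN hpack ht htT hG hτ (hγ τ hτ)
      (Torus.proj (γ τ)) rfl hg
  -- the both-ends lemma for `φ = u ∘ γ`, `g = G ∘ γ`
  have hφ : ∀ τ ∈ Icc 0 t,
      HasDerivWithinAt (fun τ => (fun j => u τ (Torus.proj (γ τ)) j : Fin 3 → ℝ))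
        (-g τ) (Icc 0 t) τ := fun τ hτ =>
    hasDerivWithinAt_pi.2 fun j => by
      rw [Pi.neg_apply]
      exact (step τ hτ).1 j
  have hgODE : ∀ τ ∈ Icc 0 t, ∃ v, HasDerivWithinAt g v (Icc 0 t) τ ∧
      ‖v‖ ≤ 38 * (K * M) ^ 5 * ‖g τ‖ + 62 * (K * M) ^ 7 := fun τ hτ => (step τ hτ).2.2
  have hb : ∀ τ ∈ Icc 0 t, ‖(fun j => u τ (Torus.proj (γ τ)) j : Fin 3 → ℝ)‖ ≤ M :=
    fun τ hτ => (pi_norm_le_iff_of_nonneg hM0.le).2 fun j =>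
      (PiLp.norm_apply_le (u τ (Torus.proj (γ τ))) j).trans (hG τ hτ _).2.2.2.2.1
  have hD : ‖(fun j => u t (Torus.proj (γ t)) j : Fin 3 → ℝ) -
      (fun j => u 0 (Torus.proj (γ 0)) j : Fin 3 → ℝ)‖ ≤ 2 * M :=
    (norm_sub_le _ _).trans (by linarith [hb t ⟨ht.le, le_rfl⟩, hb 0 ⟨le_rfl, ht.le⟩])
  have hODE := norm_le_of_both_ends
    (φ := fun τ => (fun j => u τ (Torus.proj (γ τ)) j : Fin 3 → ℝ))
    ht hφ hgODE (by positivity) (by positivity) hAt hD hs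
  rw [sub_zero] at hODE
  -- the log-slope at `(s, x)`
  have hQ := (step s hs).2.1 i
  rw [hx] at hQ
  -- final arithmetic
  have h7 : 0 ≤ (K * M) ^ 7 := by positivity
  have p27 : (K * M) ^ 2 ≤ (K * M) ^ 7 := pow_le_pow_right₀ hN (by norm_num)
  have p17 : K * M ≤ (K * M) ^ 7 := le_self_pow₀ hN (by norm_num)
  have htt : t * t ≤ 1 := by nlinarith
  have h1 : ‖g s‖ * t ≤ 3 * M + 124 * (K * M) ^ 7 * (t * t) := by
    calc ‖g s‖ * t ≤ (3 / 2 * (2 * M) / t + 2 * (62 * (K * M) ^ 7) * t) * t :=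
          mul_le_mul_of_nonneg_right hODE ht.le
      _ = 3 * M + 124 * (K * M) ^ 7 * (t * t) := by
          field_simp
          ring
  have hgt : ‖g s‖ * t ≤ 127 * (K * M) ^ 7 := by
    have h := mul_le_mul_of_nonneg_left htt (by positivity : (0 : ℝ) ≤ 124 * (K * M) ^ 7)
    linarith
  have hN2t : (K * M) ^ 2 * t ≤ (K * M) ^ 7 := by
    calc (K * M) ^ 2 * t ≤ (K * M) ^ 2 * 1 := by gcongr
      _ ≤ (K * M) ^ 7 := by rw [mul_one]; exact p27
  have h2 : 2 * (K * M) * (‖g s‖ + (K * M) ^ 2) * t ≤ 256 * (K * M) ^ 8 := by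
    calc 2 * (K * M) * (‖g s‖ + (K * M) ^ 2) * t
        = 2 * (K * M) * (‖g s‖ * t + (K * M) ^ 2 * t) := by ring
      _ ≤ 2 * (K * M) * (127 * (K * M) ^ 7 + (K * M) ^ 7) := by gcongr
      _ = 256 * (K * M) ^ 8 := by ring
  calc |Torus.partialDeriv i (fun y => Real.log (ρ s y)) x|
      ≤ 2 * (K * M) * (‖g s‖ + (K * M) ^ 2) := hQ
    _ = 2 * (K * M) * (‖g s‖ + (K * M) ^ 2) * t / t := (mul_div_cancel_right₀ _ ht0).symm
    _ ≤ 256 * (K * M) ^ 8 / t := by gcongr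
    _ = 256 * K ^ 8 * M ^ 8 / t := by rw [hpow]

end Summit.AtomisticToContinuum.HydrodynamicLimit.Theorems.ConeLocalisation.Elevator

end
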